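import Summits.QuantumFields.YangMills.Theorems.BalabanUVNodesN08ReMassedACThm2
import Summits.QuantumFields.YangMills.Theorems.BalabanUVNodesN08AlphaEq324RowACEnd

/-!
# Route «BalabanUVNodes», Track-A DAG node N08 = [Balaban1985UV3] Thm 1 p. 257 ∕ Thm 2 p. 272 — THE RE-MASSED AC TOWER READ FROM THE EDITED (α)-AC CLAUSE
# (the (3.24) row in print's output-sandwich currency at ANY cumulant letter, range-honest bundle): part 1 — the step leaves C1 `Bound55` ∕ C2 `Bound55Lower` for the
# re-massed base `{ X.toTowerBase 𝔠.lane.carrier with W := W′ }` from the edition's ROWS, and the mass-free step leaves C3–C8∕C10 at the re-massed pieces from the edition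
# (dag-n08-w1 g4's I-b `…N08ReMassedACStepBounds` and II `…N08ReMassedACThm2` §1 re-entered one (α)-currency lower; part 2 = `…RowACReMassedSlot`: the fourteen leaves,
# Theorem 2, B25 and the slot of record from the edition + the a.e. mass bound)

Cell `pub-ymgap`, seat `pub-ymgap-dag-n08-w4` gen 4 (INTENT-3; sequel of p607065∕p608282 and of dag-n08-w1's I-b∕II).  `bears_on: R4∕N08`; `--supports stmt-QuantumFields-20542`
(K1⁷, helper).  THEOREMS ONLY (def-free), sorry-free, standard axioms; dag-n08-w1's I-a∕I-b (`…N08SeriesACStepBounds`, `…N08ReMassedACStepBounds`: normal forms, the generic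
series step, the abstract a.e. transfers) and the lane's `Balaban3D/Proofs/*AC` modules consumed BY NAME, untouched.

THE POINT (located, count-neutral).  dag-n08-w1's I-b derives C1∕C2 for the re-massed base from the (α)-AC step input AS LANDED (`AlphaAC.StepAlphaAC 𝔊 𝔠 X 𝔖 𝔄 k`), reading
ONLY its rows `fibre49`, `fibre57Low`, `hU`, `hPm`, `hPb` (and `𝔄.cP k`).  Those rows are carried VERBATIM by the edition `…RowAC.StepAlphaEq324CoreLTAtAC 𝔊 𝔠 X 𝔖 𝔄 c k hk`
(range-honest `𝔄 : AlphaDataLTAC`, the (3.24) row as the printed sandwich at the letter `c`).  This file states I-b's theorems at ROW LEVEL (the five rows as hypotheses — what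
both antecedents instantiate) and instantiates them at the edition; so the re-massed road opens for a sandwich-currency supplier too.
* §1 ROW-LEVEL: `fibre57Low_reMassed_of_row` · `fibre49_reMassed_of_row` · `bound55_reMassed_of_rows` · `bound55Lower_reMassed_of_rows` (I-b's proofs verbatim, the
  `StepAlphaAC` field accesses replaced by the named rows).
* §2 AT THE EDITION: ★★ `bound55_reMassed_of_coreLTAtAC` · ★★ `bound55Lower_reMassed_of_coreLTAtAC`.
* §3 THE MASS-FREE LEAVES AT THE RE-MASSED PIECES FROM THE EDITION: ★★ `cumulant58_reMassed_of_coreLTAtAC` ∕ ★★ `cumulantLower_reMassed_of_coreLTAtAC` (C3∕C4 from the ONE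
  printed `Eq324` row at the letter `c` — p607065 §1's BASE-GENERIC `cumulant58∕cumulantLower_series_stdAC_of_eq324_at` at `B′`, (25) for the activities from p608282's
  `bound25_act_coreLTAtAC`), `repr33_60∕vacuumWhole∕decomp35_61∕norm35∕logZT_le∕oldOutside_reMassed_of_coreLTAtAC` (II §1's proofs with the edition's rows; C7 reads the
  RANGE-HONEST binder `𝔄.Λc k hk`); C9∕C11–C14 and (1)₀ are II's `starCount∕ztermSucc∕rmSucc∕step0_reMassed` BY NAME (they read neither the (α) rows nor `𝔄`).
HONEST FRAMING: count-neutral helper; no `W′` exhibited here; the edited (α)-AC rows and the `W′`-hypotheses are HYPOTHESES (N08's object gap in AC currency); N08 NOT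
discharged; one finite 𝕋⁴ programme at fixed ε, Bałaban AS PRINTED — R4 closes the conditional finite-𝕋⁴ rung `BalabanLadder.UV` only; the Yang–Mills mass gap (Clay) is NOT
proved by any of this; nothing continuum ∕ ℝ⁴ ∕ OS.

References: [Balaban1985UV3] T. Bałaban, Commun. Math. Phys. 102 (1985) 255–275 — (22) p. 261, (41) p. 266, (47)–(49) pp. 267–268, (55) p. 269, (58) p. 270, p. 272 L32–33;
[Balaban1982Higgs1] (3.24) p. 616.
-/

noncomputable section

open MeasureTheory Metric
open scoped BigOperators

namespace Summit.QuantumFields.YangMills.Theorems.BalabanUVNodesN08AlphaEq324RowACReMassed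

open Literature.MathematicalPhysics.QuantumFieldTheory.Balaban1983to89
open Literature.MathematicalPhysics.QuantumFieldTheory.Balaban1983to89.AveragingRT (rnTransport rnTransport_nonneg)
open Literature.MathematicalPhysics.QuantumFieldTheory.Balaban1983to89.B10
open Literature.MathematicalPhysics.QuantumFieldTheory.Balaban1983to89.B10SectAGathering
open Literature.MathematicalPhysics.QuantumFieldTheory.Balaban1983to89.TreeLengthTorus (tsys TPt)
open Literature.MathematicalPhysics.QuantumFieldTheory.Balaban1985CMP102.Binders (LogZLocalizedAsCited)
open Literature.MathematicalPhysics.QuantumFieldTheory.Balaban1985CMP102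
open Literature.MathematicalPhysics.QuantumFieldTheory.Balaban1985CMP102.Setting
open Summit.QuantumFields.Balaban3D
open Summit.QuantumFields.Balaban3D.Carriers
open Summit.QuantumFields.Balaban3D.Proofs
open Summit.QuantumFields.Balaban3D.Proofs.TowerAC
open Summit.QuantumFields.Balaban3D.Proofs.SeriesAC
open Summit.QuantumFields.Balaban3D.Proofs.StandardAC
open Summit.QuantumFields.Balaban3D.Proofs.InputsAC
open Summit.QuantumFields.Balaban3D.Proofs.MassesAC
open Summit.QuantumFields.Balaban3D.Proofs.Bound55AC
open Summit.QuantumFields.Balaban3D.Proofs.Bound55Masses (chiB chiB_nonneg chiB_le_one measurable_chiB measurable_stepWeight stepWeight_mul_chiB_cover)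
open Summit.QuantumFields.Balaban3D.Proofs.AlphaAC (AlphaDataAC StepAlphaAC)
open Summit.QuantumFields.Balaban3D.Proofs.GroupModelLieC (lieC)
open Summit.QuantumFields.Balaban3D.Proofs.ScalesArithmetic
open Summit.QuantumFields.Balaban3D.Proofs.Inputs (nblk_cube_le_sites)
open Summit.QuantumFields.Balaban3D.Proofs.FamilyLE (thresholds_of_le)
open Summit.QuantumFields.Balaban3D.Proofs.UVStability3DInputs (adjAct hdet_adjAct)
open Summit.QuantumFields.YangMills.BalabanUVNodes.N08SeriesACStepBounds
open Summit.QuantumFields.YangMills.BalabanUVNodes.N08ReMassedACStepBounds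
open Summit.QuantumFields.YangMills.BalabanUVNodes.N08ReMassedACThm2 (starCount_reMassed ztermSucc_reMassed rmSucc_reMassed step0_reMassed)
open Summit.QuantumFields.YangMills.Theorems.BalabanUVNodesN08AlphaEq324RowAC
open Summit.QuantumFields.YangMills.Theorems.BalabanUVNodesN08AlphaEq324RowACEnd (bound25_act_coreLTAtAC)

variable {L : ℕ} {S : Scales L} {G : Type} [GaugeGroup G] [MeasurableSpace G] [HaarData G]

/-! ## §1 C1 ∕ C2 for the re-massed base at ROW LEVEL -/
section Rows

variable {𝔊 : GroupModel G} {𝔠 : Primitives.AlphaConsts L 𝔊.N} {X : ExternalInputsAC S G}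
  {𝔖 : ∀ k, StepSeries S G ↥(lieC 𝔊) (nblkOf S 𝔠.lane.carrier k) k}
  (W' : HistWeightsAC S.P G)
  (hae : ∀ j, j ≤ S.K → ∀ h : Hist S.P j, W'.mass j h =ᵐ[fieldMeasure S.P j G]
    massRecAC 𝔠.lane.carrier.M₁ (rcolOf S 𝔠.lane.carrier) (eps1Of S 𝔠.lane.carrier) (epsSOf S 𝔠.lane.carrier) X.av j h)
  (hle : ∀ (j : ℕ) (h : Hist S.P j) (U : GaugeField S.P j G),
    W'.mass j h U ≤ massRecAC 𝔠.lane.carrier.M₁ (rcolOf S 𝔠.lane.carrier) (eps1Of S 𝔠.lane.carrier) (epsSOf S 𝔠.lane.carrier) X.av j h U)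
  (B' : TowerBaseAC S G) (hB' : B' = { X.toTowerBase 𝔠.lane.carrier with W := W' })

include hB' in
/-- **R3D-02 FOR THE RE-MASSED BASE FROM THE ROW `Fibre57LowAC`** (it reads no mass; dag-n08-w1's `fibre57Low_reMassed` with the row as a hypothesis instead of the field
`StepAlphaAC.fibre57Low`). [cite: Balaban1985UV3, p.265 L21–28 + (47) p.267 + p.272 L32–33] -/
theorem fibre57Low_reMassed_of_row {k : ℕ} (hrow : Fibre57LowAC X 𝔠.lane.carrier 𝔖 (fun _ => True) k (piecesWAC 𝔠.lane X 𝔖 k)) :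
    (fun V => ((B'.withSeriesAC 𝔖 (piecesParamsOf S 𝔠.lane.carrier)).towerWith fun _ => True).chi (k + 1) V *
        Real.exp (-(((B'.withSeriesAC 𝔖 (piecesParamsOf S 𝔠.lane.carrier)).towerWith fun _ => True).mainT (k + 1) (Hist.triv S.P (k + 1)) V)
          - ((B'.withSeriesAC 𝔖 (piecesParamsOf S 𝔠.lane.carrier)).towerWith fun _ => True).Ecst k
          + ((piecesParamsOf S 𝔠.lane.carrier k).logσ₀ + (piecesParamsOf S 𝔠.lane.carrier k).dg * Real.log (S.gk k)) *
              (piecesParamsOf S 𝔠.lane.carrier k).starB (Hist.triv S.P (k + 1))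
          + (𝔖 k).logZU (Hist.triv S.P (k + 1)) V + (𝔖 k).Pold B'.M₁ B'.Rcol (Hist.triv S.P (k + 1)) V
          - ((B'.withSeriesAC 𝔖 (piecesParamsOf S 𝔠.lane.carrier)).towerWith fun _ => True).Rm k + (𝔖 k).logFl (Hist.triv S.P (k + 1)) V))
      ≤ᵐ[fieldMeasure S.P (k + 1) G] rnTransport (B'.av k).avg (fun U =>
        ((B'.withSeriesAC 𝔖 (piecesParamsOf S 𝔠.lane.carrier)).towerWith fun _ => True).chi k U *
        Real.exp (-(((B'.withSeriesAC 𝔖 (piecesParamsOf S 𝔠.lane.carrier)).towerWith fun _ => True).mainT k (Hist.triv S.P k) U)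
          + (B'.withSeriesAC 𝔖 (piecesParamsOf S 𝔠.lane.carrier)).Pint k (Hist.triv S.P k) U
          - ((B'.withSeriesAC 𝔖 (piecesParamsOf S 𝔠.lane.carrier)).towerWith fun _ => True).Ecst k
          - ((B'.withSeriesAC 𝔖 (piecesParamsOf S 𝔠.lane.carrier)).towerWith fun _ => True).Rm k)) := by
  subst hB'
  have hf := hrow
  unfold Fibre57LowAC at hf
  dsimp only [stdTowerInputAC, towerInputOfAC] at hf
  simp only [towerWith_chi, towerWith_mainT, towerWith_Ecst, towerWith_Rm, withSeriesAC_Pint] at hf ⊢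
  dsimp only [piecesWAC, piecesAC, TowerBaseAC.seriesPiecesAC, TowerInputAC.pieces3, ExternalInputsAC.toTowerBase, piecesParamsOf,
    StepSeries.toStepData] at hf ⊢
  exact hf

include hB' hae in
/-- **R3D-01 FOR THE RE-MASSED BASE FROM THE ROW `Fibre49AC`** (`k ≤ K`; dag-n08-w1's `fibre49_reMassed`, row as hypothesis; the abstract transfer `fibre_le_ae_congr`
along `W′_k =ᵐ m_k`). [cite: Balaban1985UV3, (49)–(58) pp.268–270 (bookkeeping)] -/
theorem fibre49_reMassed_of_row {k : ℕ} (hk : k ≤ S.K) (h' : Hist S.P (k + 1))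
    (hrow : Fibre49AC X 𝔠.lane.carrier 𝔖 (fun _ => True) k (piecesWAC 𝔠.lane X 𝔖 k) h') :
    (rnTransport (B'.av k).avg (fun U =>
        stepWeight B'.M₁ B'.Rcol (eps1Of S 𝔠.lane.carrier) (epsSOf S 𝔠.lane.carrier) k h' U * chiB B'.M₁ B'.Rcol (eps1Of S 𝔠.lane.carrier) k h' U *
        (B'.W.mass k h'.proj U *
          Real.exp (-(((B'.withSeriesAC 𝔖 (piecesParamsOf S 𝔠.lane.carrier)).towerWith fun _ => True).mainT k h'.proj U)
            + (B'.withSeriesAC 𝔖 (piecesParamsOf S 𝔠.lane.carrier)).Pint k h'.proj U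
            - ((B'.withSeriesAC 𝔖 (piecesParamsOf S 𝔠.lane.carrier)).towerWith fun _ => True).Ecst k
            + ((B'.withSeriesAC 𝔖 (piecesParamsOf S 𝔠.lane.carrier)).towerWith fun _ => True).Zterm k h'.proj
            + ((B'.withSeriesAC 𝔖 (piecesParamsOf S 𝔠.lane.carrier)).towerWith fun _ => True).Rm k))))
      ≤ᵐ[fieldMeasure S.P (k + 1) G] fun V => rnTransport (B'.av k).avg (fun U =>
        stepWeight B'.M₁ B'.Rcol (eps1Of S 𝔠.lane.carrier) (epsSOf S 𝔠.lane.carrier) k h' U * B'.W.mass k h'.proj U) V *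
        Real.exp (-(((B'.withSeriesAC 𝔖 (piecesParamsOf S 𝔠.lane.carrier)).towerWith fun _ => True).mainT (k + 1) h' V)
          - ((B'.withSeriesAC 𝔖 (piecesParamsOf S 𝔠.lane.carrier)).towerWith fun _ => True).Ecst k
          + ((piecesParamsOf S 𝔠.lane.carrier k).logσ₀ + (piecesParamsOf S 𝔠.lane.carrier k).dg * Real.log (S.gk k)) *
              (piecesParamsOf S 𝔠.lane.carrier k).starB h'
          + (𝔖 k).logZU h' V + (𝔖 k).Pold B'.M₁ B'.Rcol h' V
          + ((B'.withSeriesAC 𝔖 (piecesParamsOf S 𝔠.lane.carrier)).towerWith fun _ => True).Zterm k (Hist.proj h')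
          + ((B'.withSeriesAC 𝔖 (piecesParamsOf S 𝔠.lane.carrier)).towerWith fun _ => True).Rm k
          + (𝔖 k).logFl h' V) := by
  subst hB'
  have hf := hrow
  unfold Fibre49AC at hf
  dsimp only [stdTowerInputAC, towerInputOfAC] at hf
  simp only [towerWith_mainT, towerWith_Ecst, towerWith_Rm, towerWith_Zterm, withSeriesAC_Pint] at hf ⊢
  dsimp only [piecesWAC, piecesAC, TowerBaseAC.seriesPiecesAC, TowerInputAC.pieces3, ExternalInputsAC.toTowerBase, piecesParamsOf,
    StepSeries.toStepData, histWeightsAC] at hf ⊢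
  exact fibre_le_ae_congr _ _ (stepWeight_nonneg _ _ _ _ k h') (chiB_nonneg _ _ _ k h') (massRecAC_nonneg _ _ _ _ _ k h'.proj)
    (W'.mass_nonneg k h'.proj) (hae k hk h'.proj) hf

variable (hWm : ∀ (j : ℕ) (h : Hist S.P j), Measurable (W'.mass j h)) (hmt : ∀ (j : ℕ) (U : GaugeField S.P j G), 1 ≤ W'.mass j (Hist.triv S.P j) U)

include hB' hae hle hWm hmt in
/-- ★ **C1 `Bound55` FOR THE RE-MASSED BASE FROM THE ROWS** `hU`, `hPm`, `hPb` (at the AC input's interaction sum, bound `cP`) and `Fibre49AC` (`k + 1 ≤ K`) — dag-n08-w1's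
`bound55_reMassed` with the `StepAlphaAC` fields replaced by the named rows. [cite: Balaban1985UV3, (22) p.261 + (48)–(49) pp.267–268 + (55) p.269 + (58) p.270] -/
theorem bound55_reMassed_of_rows {k : ℕ} (hk : k + 1 ≤ S.K) (hU : ∀ h : Hist S.P k, Measurable (X.UkH k h))
    (hPm : ∀ h : Hist S.P k, Measurable ((inputOfAC 𝔠.lane X 𝔖).Pint k h)) {cP : ℝ}
    (hPb : ∀ (h : Hist S.P k) (U : GaugeField S.P k G), (inputOfAC 𝔠.lane X 𝔖).Pint k h U ≤ cP)
    (hfibre : ∀ h' : Hist S.P (k + 1), Fibre49AC X 𝔠.lane.carrier 𝔖 (fun _ => True) k (piecesWAC 𝔠.lane X 𝔖 k) h') :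
    Bound55 (B'.seriesPiecesAC 𝔖 (piecesParamsOf S 𝔠.lane.carrier) k) := by
  haveI : RegularGaugeGroup G := Carriers.groupModel_regularGaugeGroup 𝔊
  have hfib := fun h' => fibre49_reMassed_of_row W' hae B' hB' (by omega) h' (hfibre h')
  subst hB'
  refine bound55_seriesPiecesAC _ 𝔖 (piecesParamsOf S 𝔠.lane.carrier) (eps1Of S 𝔠.lane.carrier) (epsSOf S 𝔠.lane.carrier) k
    (AlphaBound55.eps1Of_le_epsSOf k 𝔠.lane.carrier 𝔠.lane.F.b₀_nonneg 𝔠.lane.F.p₀_pos.le (by omega))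
    (fun h' => transport_le_reMassed_ae W' hae hk h')
    (fun h U hh => reMassed_mass_eq_zero_of_not_admissible W' hle k h U hh)
    (fun V => hmt (k + 1) V)
    (rm_nonneg_seriesAC _ 𝔖 _ k fun j => ?_)
    (hint_seriesAC _ 𝔖 _ k (fun h => hU h) (fun h => hPm h) cP (fun h U => hPb h U)
      (fun h => integrable_reMassed W' hle hWm k h))
    hfib
  show 0 ≤ 𝔠.lane.sc.rstar * S.g ^ ((6 : ℝ) + 2 * 𝔠.lane.F.κ₀)
  exact mul_nonneg 𝔠.lane.sc.rstar_nonneg (Real.rpow_nonneg S.g_pos.le _)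

include hB' in
/-- ★ **C2 `Bound55Lower` FOR THE RE-MASSED BASE FROM THE ROWS** `hU`, `hPm`, `hPb` at the trivial history and `Fibre57LowAC` — dag-n08-w1's `bound55Lower_reMassed`, rows
named. [cite: Balaban1985UV3, p.265 L21–28 + (47) p.267 + p.272 L32–33] -/
theorem bound55Lower_reMassed_of_rows {k : ℕ} (hU : Measurable (X.UkH k (Hist.triv S.P k)))
    (hPm : Measurable ((inputOfAC 𝔠.lane X 𝔖).Pint k (Hist.triv S.P k))) {cP : ℝ}
    (hPb : ∀ U : GaugeField S.P k G, (inputOfAC 𝔠.lane X 𝔖).Pint k (Hist.triv S.P k) U ≤ cP)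
    (hfibreLow : Fibre57LowAC X 𝔠.lane.carrier 𝔖 (fun _ => True) k (piecesWAC 𝔠.lane X 𝔖 k)) :
    Bound55Lower (B'.seriesPiecesAC 𝔖 (piecesParamsOf S 𝔠.lane.carrier) k) := by
  haveI : RegularGaugeGroup G := Carriers.groupModel_regularGaugeGroup 𝔊
  have hfl := fibre57Low_reMassed_of_row W' B' hB' hfibreLow
  subst hB'
  exact bound55Lower_seriesPiecesAC _ 𝔖 (piecesParamsOf S 𝔠.lane.carrier) k (hint47_seriesAC _ 𝔖 _ k hU hPm cP hPb) hfl

end Rows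

/-! ## §2 C1 ∕ C2 for the re-massed base FROM THE EDITED (α)-AC STEP LIST at an arbitrary cumulant letter -/
section Edition

variable {𝔊 : GroupModel G} {𝔠 : Primitives.AlphaConsts L 𝔊.N} {X : ExternalInputsAC S G}
  {𝔖 : ∀ k, StepSeries S G ↥(lieC 𝔊) (nblkOf S 𝔠.lane.carrier k) k} {𝔄 : AlphaDataLTAC 𝔊 𝔠 X 𝔖}
  {c : ∀ k, Hist S.P (k + 1) → GaugeField S.P (k + 1) G → ℕ → ℝ}
  (W' : HistWeightsAC S.P G)
  (hae : ∀ j, j ≤ S.K → ∀ h : Hist S.P j, W'.mass j h =ᵐ[fieldMeasure S.P j G]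
    massRecAC 𝔠.lane.carrier.M₁ (rcolOf S 𝔠.lane.carrier) (eps1Of S 𝔠.lane.carrier) (epsSOf S 𝔠.lane.carrier) X.av j h)
  (hle : ∀ (j : ℕ) (h : Hist S.P j) (U : GaugeField S.P j G),
    W'.mass j h U ≤ massRecAC 𝔠.lane.carrier.M₁ (rcolOf S 𝔠.lane.carrier) (eps1Of S 𝔠.lane.carrier) (epsSOf S 𝔠.lane.carrier) X.av j h U)
  (hWm : ∀ (j : ℕ) (h : Hist S.P j), Measurable (W'.mass j h)) (hmt : ∀ (j : ℕ) (U : GaugeField S.P j G), 1 ≤ W'.mass j (Hist.triv S.P j) U)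
  (B' : TowerBaseAC S G) (hB' : B' = { X.toTowerBase 𝔠.lane.carrier with W := W' })

include hB' hae hle hWm hmt in
/-- ★★ **C1 `Bound55` FOR THE RE-MASSED BASE FROM THE EDITED (α)-AC STEP LIST** `StepAlphaEq324CoreLTAtAC 𝔊 𝔠 X 𝔖 𝔄 c k hk` (ANY letter `c`, range-honest `𝔄`) + the
four `W′`-hypotheses — its rows `hU`∕`hPm`∕`hPb`∕`fibre49` are `StepAlphaAC`'s verbatim. [cite: Balaban1985UV3, (22) p.261 + (48)–(49) pp.267–268 + (55) p.269 + (58) p.270; Balaban1982Higgs1, (3.24) p.616] -/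
theorem bound55_reMassed_of_coreLTAtAC {k : ℕ} (hk : k + 1 ≤ S.K) (A : StepAlphaEq324CoreLTAtAC 𝔊 𝔠 X 𝔖 𝔄 c k hk) :
    Bound55 (B'.seriesPiecesAC 𝔖 (piecesParamsOf S 𝔠.lane.carrier) k) :=
  bound55_reMassed_of_rows W' hae hle B' hB' hWm hmt hk A.hU A.hPm A.hPb A.fibre49

include hB' in
/-- ★★ **C2 `Bound55Lower` FOR THE RE-MASSED BASE FROM THE EDITED (α)-AC STEP LIST** (any letter). [cite: Balaban1985UV3, p.265 L21–28 + (47) p.267 + p.272 L32–33] -/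
theorem bound55Lower_reMassed_of_coreLTAtAC {k : ℕ} {hk : k + 1 ≤ S.K} (A : StepAlphaEq324CoreLTAtAC 𝔊 𝔠 X 𝔖 𝔄 c k hk) :
    Bound55Lower (B'.seriesPiecesAC 𝔖 (piecesParamsOf S 𝔠.lane.carrier) k) :=
  bound55Lower_reMassed_of_rows W' B' hB' (A.hU _) (A.hPm _) (fun U => A.hPb _ U) A.fibre57Low

include hB' in
open Classical in
/-- ★★ **C3 AT THE RE-MASSED PIECES FROM THE ONE PRINTED `Eq324` ROW AT THE LETTER `c`** (p607065 §1's base-generic `cumulant58_series_stdAC_of_eq324_at` at `B′`; (25) for the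
activities from p608282's `bound25_act_coreLTAtAC`; constant `Ca + 0 + Cc` of the record read as `Ca + Cc`). [cite: Balaban1985UV3, (24) p.262 + (58)–(59) p.270; Balaban1982Higgs1, (3.24) p.616] -/
theorem cumulant58_reMassed_of_coreLTAtAC (hfam : S.g ^ 2 * S.ε₀ ≤ (min 𝔠.gamma0 1) ^ 2) {k : ℕ} (hk : k + 1 ≤ S.K)
    (A : StepAlphaEq324CoreLTAtAC 𝔊 𝔠 X 𝔖 𝔄 c k hk) :
    Cumulant58 (B'.seriesPiecesAC 𝔖 (piecesParamsOf S 𝔠.lane.carrier) k) 𝔠.lane.sc.Cz 𝔠.lane.sc.C₁ := by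
  subst hB'
  have hC₂ : 0 ≤ 𝔠.Ca + 0 + 𝔠.Cc := by simpa only [add_zero] using 𝔠.Cac_nonneg
  have h324' : ∀ h (U : GaugeField S.P (k + 1) G),
      B1Sect3Statements.Eq324 (∫ ω in (𝔖 k).box h, Real.exp ((𝔖 k).𝒱 h U ω) ∂(𝔖 k).μ) (c k h U) 𝔠.nbar (𝔠.Ca + 0 + 𝔠.Cc)
        ((L : ℝ) ^ k * S.g0sq) (3 + 𝔠.κ₀) (S.sites k) := fun h U => by simpa only [add_zero] using A.h324 h U
  exact cumulant58_series_stdAC_of_eq324_at _ 𝔖 (piecesParamsOf S 𝔠.lane.carrier) k 𝔠.kappa_ge 𝔠.C25_nonneg A.hact (c k) h324' hC₂ (by omega)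
    𝔠.lane.F.κ₀_pos 𝔠.one_le_r₀ 𝔠.R₁_ge (norm_rem_eq S 𝔠.lane.F.κ₀ k).symm rfl (nblk_cube_le_sites 𝔠.lane k (by omega)) A.hG
    (bound25_act_coreLTAtAC hfam A)

include hB' in
open Classical in
/-- ★★ **C4 AT THE RE-MASSED PIECES FROM THE ONE PRINTED `Eq324` ROW AT THE LETTER `c`** (`cumulantLower_series_stdAC_of_eq324_at` at `B′`).
[cite: Balaban1985UV3, (37) p.265 + p.272 + (59) p.270; Balaban1982Higgs1, (3.24) p.616] -/
theorem cumulantLower_reMassed_of_coreLTAtAC (hfam : S.g ^ 2 * S.ε₀ ≤ (min 𝔠.gamma0 1) ^ 2) {k : ℕ} (hk : k + 1 ≤ S.K)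
    (A : StepAlphaEq324CoreLTAtAC 𝔊 𝔠 X 𝔖 𝔄 c k hk) :
    CumulantLower (B'.seriesPiecesAC 𝔖 (piecesParamsOf S 𝔠.lane.carrier) k) 𝔠.lane.sc.C₁' := by
  subst hB'
  have hC₂ : 0 ≤ 𝔠.Ca + 0 + 𝔠.Cc := by simpa only [add_zero] using 𝔠.Cac_nonneg
  have h324' : ∀ h (U : GaugeField S.P (k + 1) G),
      B1Sect3Statements.Eq324 (∫ ω in (𝔖 k).box h, Real.exp ((𝔖 k).𝒱 h U ω) ∂(𝔖 k).μ) (c k h U) 𝔠.nbar (𝔠.Ca + 0 + 𝔠.Cc)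
        ((L : ℝ) ^ k * S.g0sq) (3 + 𝔠.κ₀) (S.sites k) := fun h U => by simpa only [add_zero] using A.h324 h U
  exact cumulantLower_series_stdAC_of_eq324_at _ 𝔖 (piecesParamsOf S 𝔠.lane.carrier) k 𝔠.kappa_ge 𝔠.C25_nonneg A.hact (c k) h324' hC₂ (by omega)
    𝔠.lane.F.κ₀_pos 𝔠.one_le_r₀ 𝔠.R₁_ge (norm_rem_eq S 𝔠.lane.F.κ₀ k).symm rfl (nblk_cube_le_sites 𝔠.lane k (by omega)) A.hG
    (bound25_act_coreLTAtAC hfam A)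

include hB' in
/-- **C5 at the re-massed pieces from the edition's rows** (II's `repr33_60_reMassed`, rows `chart∕bound28∕inv26∕far_le∕hPY`). [cite: Balaban1985UV3, (33) p.264 + (60) p.271] -/
theorem repr33_60_reMassed_of_coreLTAtAC (hfam : S.g ^ 2 * S.ε₀ ≤ (min 𝔠.gamma0 1) ^ 2) {k : ℕ} (hk : k + 1 ≤ S.K)
    (A : StepAlphaEq324CoreLTAtAC 𝔊 𝔠 X 𝔖 𝔄 c k hk) :
    Repr33_60 (B'.seriesPiecesAC 𝔖 (piecesParamsOf S 𝔠.lane.carrier) k) 𝔠.lane.sc.C₂ := by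
  subst hB'
  exact LeavesReprAC.repr33_60_seriesAC _ 𝔖 (piecesParamsOf S 𝔠.lane.carrier) k (by omega) 𝔠.chart (by linarith [𝔠.kappa_ge]) 𝔠.C25_nonneg
    𝔠.C25_le 𝔠.κ₀_lt_half 𝔠.lane.F.p₀_pos 𝔠.lane.F.b₀_nonneg (nblk_cube_le_sites 𝔠.lane k (by omega)) (Run3RepresentationStd.rem_std 𝔠.lane.carrier k)
    A.chart A.bound28 (thresholds_of_le hfam k (by omega)).2.2.2.2 (adjAct 𝔊 (P := S.P) k) A.inv26 (hdet_adjAct 𝔊 k) A.far_le A.hPY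

include hB' in
/-- **C6 at the re-massed pieces from the edition's row `chart`** (II's `vacuumWhole_reMassed`). [cite: Balaban1985UV3, p.265 + p.270 + (25) p.262] -/
theorem vacuumWhole_reMassed_of_coreLTAtAC {k : ℕ} (hk : k + 1 ≤ S.K) (A : StepAlphaEq324CoreLTAtAC 𝔊 𝔠 X 𝔖 𝔄 c k hk) :
    VacuumWhole (B'.seriesPiecesAC 𝔖 (piecesParamsOf S 𝔠.lane.carrier) k) 𝔠.lane.sc.Cv 𝔠.lane.sc.C₃ := by
  subst hB'
  exact LeavesReprAC.vacuumWhole_seriesAC _ 𝔖 (piecesParamsOf S 𝔠.lane.carrier) k (by omega) 𝔠.kappa_ge 𝔠.C25_nonneg 𝔠.lane.F.κ₀_pos 𝔠.one_le_r₀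
    𝔠.R₁_ge (nblk_cube_le_sites 𝔠.lane k (by omega)) (Run3RepresentationStd.rem_std 𝔠.lane.carrier k) rfl A.chart

include hB' in
/-- **C7 at the re-massed pieces from the edition's rows `bound28`∕`hPYZ` and the RANGE-HONEST binder `𝔄.Λc k hk`** (II's `decomp35_61_reMassed`, the (63) binder re-typed at the
re-massed tower field by field along I-a's normal forms). [cite: Balaban1985UV3, (61) p.271 + (63) p.272 + (35) p.265] -/
theorem decomp35_61_reMassed_of_coreLTAtAC (hfam : S.g ^ 2 * S.ε₀ ≤ (min 𝔠.gamma0 1) ^ 2) {k : ℕ} (hk : k + 1 ≤ S.K)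
    (A : StepAlphaEq324CoreLTAtAC 𝔊 𝔠 X 𝔖 𝔄 c k hk) :
    Decomp35_61 (B'.seriesPiecesAC 𝔖 (piecesParamsOf S 𝔠.lane.carrier) k) 𝔠.lane.sc.C₄ := by
  subst hB'
  let Λ' : LogZLocalizedAsCited (({ X.toTowerBase 𝔠.lane.carrier with W := W' } : TowerBaseAC S G).withSeriesAC 𝔖
        (piecesParamsOf S 𝔠.lane.carrier)).tower3.toTowerRun k (𝔖 k).E (adjAct 𝔊 (P := S.P) k) 𝔠.ρ 𝔠.r₀ 𝔠.Cfar 𝔠.C63 𝔠.κ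
      ((({ X.toTowerBase 𝔠.lane.carrier with W := W' } : TowerBaseAC S G).seriesPiecesAC 𝔖 (piecesParamsOf S 𝔠.lane.carrier) k).logZU)
      ((({ X.toTowerBase 𝔠.lane.carrier with W := W' } : TowerBaseAC S G).seriesPiecesAC 𝔖 (piecesParamsOf S 𝔠.lane.carrier) k).logZ1)
      (𝔖 k).Bcfg (fun h => Finset.univ.filter fun Y : (tsys 3 (nblkOf S 𝔠.lane.carrier k)).Dom =>
        Y.1 ⊆ ΩblkOf ({ X.toTowerBase 𝔠.lane.carrier with W := W' } : TowerBaseAC S G).M₁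
          ({ X.toTowerBase 𝔠.lane.carrier with W := W' } : TowerBaseAC S G).Rcol (nblkOf S 𝔠.lane.carrier k) h) :=
    { Ψ := (𝔄.Λc k hk).Ψ
      expandDiff := fun h U => by
        have e := (𝔄.Λc k hk).expandDiff (@id (Hist S.P (k + 1)) h) (@id (GaugeField S.P (k + 1) G) U)
        rw [seriesPiecesAC_logZU, seriesPiecesAC_logZ1]
        exact e
      chart := (𝔄.Λc k hk).chart
      inv26 := (𝔄.Λc k hk).inv26
      far := ((𝔄.Λc k hk).far : (tsys 3 (nblkOf S 𝔠.lane.carrier k)).Dom → Hist S.P (k + 1) → GaugeField S.P (k + 1) G → ℝ)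
      far_le := by
        have h := (𝔄.Λc k hk).far_le
        simp only [tower3_g, tower3_b₀, tower3_p₀, withSeriesAC_b₀, withSeriesAC_p₀] at h ⊢
        dsimp only [inputOfAC, stdTowerInputAC, towerInputOfAC, ExternalInputsAC.toTowerBase] at h ⊢
        simp only [withSeriesAC_b₀, withSeriesAC_p₀] at h
        exact h }
  have hr : 𝔠.chart.r₀ = 𝔠.lane.F.r₀ := rfl
  have h := LeavesReprAC.decomp35_61_seriesAC ({ X.toTowerBase 𝔠.lane.carrier with W := W' } : TowerBaseAC S G) 𝔖 (piecesParamsOf S 𝔠.lane.carrier) k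
    (by omega) 𝔠.chart (κ := 𝔠.κ) (C63 := 𝔠.C63) (R₁ := 𝔠.lane.F.R₁)
    (by linarith [𝔠.kappa_ge]) 𝔠.C63_nonneg 𝔠.C63_le (hr ▸ 𝔠.one_le_r₀) 𝔠.lane.F.κ₀_pos 𝔠.κ₀_lt_half 𝔠.R₁_ge 𝔠.lane.F.p₀_pos 𝔠.lane.F.b₀_nonneg
    (nblk_cube_le_sites 𝔠.lane k (by omega)) (Run3RepresentationStd.rem_std 𝔠.lane.carrier k) (by rw [hr]; rfl) A.bound28
    (thresholds_of_le hfam k (by omega)).2.2.2.2 (LogZLocalized.LogZLocalization.ofCited Λ' (hdet_adjAct 𝔊 k)) (fun h U => A.hPYZ h U)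
  rw [hr] at h
  exact h

include hB' in
/-- **C8 at the re-massed pieces from the edition's G3D-04 row** (II's `norm35_reMassed`). [cite: Balaban1985UV3, (35) p.265] -/
theorem norm35_reMassed_of_coreLTAtAC {k : ℕ} {hk : k + 1 ≤ S.K} (A : StepAlphaEq324CoreLTAtAC 𝔊 𝔠 X 𝔖 𝔄 c k hk) :
    Norm35 (B'.seriesPiecesAC 𝔖 (piecesParamsOf S 𝔠.lane.carrier) k) 𝔠.lane.sc.C₅ := by
  subst hB'
  have h := AlphaAdaptersAC.norm35_piecesAC 𝔠.lane X 𝔖 k 𝔠.c35_pos rfl A.norm35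
  exact fun h' => h h'

include hB' in
/-- **B20 at the re-massed pieces from the edition's G3D-05 row** (II's `logZT_le_reMassed`). [cite: Balaban1985UV3, (65) p.273] -/
theorem logZT_le_reMassed_of_coreLTAtAC {k : ℕ} {hk : k + 1 ≤ S.K} (A : StepAlphaEq324CoreLTAtAC 𝔊 𝔠 X 𝔖 𝔄 c k hk) :
    |(B'.seriesPiecesAC 𝔖 (piecesParamsOf S 𝔠.lane.carrier) k).logZT| ≤ 𝔠.lane.consts.z * S.sites k := by
  subst hB'
  exact AlphaAdaptersAC.logZT_le_piecesAC 𝔠.lane X 𝔖 k 𝔠.cT_pos rfl A.logZT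

include hB' in
/-- **C10 at the re-massed pieces from the edition's class-I rows `h44`∕`hfloor`** (II's `oldOutside_reMassed`). [cite: Balaban1985UV3, p.272 L29–31 + (44) p.267] -/
theorem oldOutside_reMassed_of_coreLTAtAC (hfam : S.g ^ 2 * S.ε₀ ≤ (min 𝔠.gamma0 1) ^ 2) {k : ℕ} (hk : k + 1 ≤ S.K)
    (A : StepAlphaEq324CoreLTAtAC 𝔊 𝔠 X 𝔖 𝔄 c k hk) :
    OldOutside (B'.seriesPiecesAC 𝔖 (piecesParamsOf S 𝔠.lane.carrier) k) 𝔠.lane.sc.C₆ := by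
  subst hB'
  have hC₆ : 𝔠.lane.sc.C₆ = 𝔠.C44 / 2 * (8 * (𝔠.lane.F.M₁ : ℝ) ^ 6)
      * (48 / (𝔠.κ₁ / 2) ^ 3 * Real.exp (𝔠.κ₁ / 2 / 2) / (1 - Real.exp (-(𝔠.κ₁ / 2 / 2)))) * (𝔠.lane.F.M₁ : ℝ)⁻¹ ^ 3 * ((L : ℝ) / ((L : ℝ) - 1)) := rfl
  rw [hC₆]
  exact LeavesOldAC.oldOutside_series_gammaAC _ 𝔖 (piecesParamsOf S 𝔠.lane.carrier) k
    (by show k + 1 ≤ S.m + S.K; omega) 𝔠.C44_nonneg 𝔠.B₃_pos.le 𝔠.κ₁_pos 𝔠.lane.F.M₁_pos 𝔠.lane.F.b₀_pos 𝔠.lane.F.p₀_pos (gk_pos S k)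
    (gk_le_one S S.gK_le_one k (by omega)) A.h44 A.hfloor (thresholds_of_le hfam k (by omega)).2.2.1

end Edition

end Summit.QuantumFields.YangMills.Theorems.BalabanUVNodesN08AlphaEq324RowACReMassed

end
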